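import Literature.MathematicalPhysics.QuantumLattice.IsotropicSectors
import Literature.MathematicalPhysics.QuantumLattice.SectorPropagatorSupBound
import HarnessLib

/-!
# Isotropic single-scale sector propagators and their dimensional bound `|ḡ^{(h)}_ω̄(x)| ≤ Cγ^{2h}`
(Benfatto–Giuliani–Mastropietro 2006, (2.59)–(2.60) at order zero)

Topic `Literature/MathematicalPhysics/QuantumLattice`; companion of `SectorPropagatorSupBound.lean`
built on the two-index cutoffs of `IsotropicSectors.lean`. We introduce the **two-index symbol and
propagator** `genSymbol e₀ μ n m ω = f_{-n} ζ_{m,ω} χ / D`, `genPropagator` (scale index `n`,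
angular index `m`; `m = n` is `sectorPropagator`, definitionally, and `m = 2n` is the isotropic
propagator `ḡ^{(h)}_ω̄` of BGM (2.59), here in our conventions: continuum `k₀`, central zone copy,
full momentum `k` in the phase) and PROVE, uniformly in `(n, m)`:

* `norm_genSymbol_le` — `‖symbol‖ ≤ (e₀4^{-n-2})⁻¹`; `genSymbol_ne_zero` — the support is the box
  `|k₀| ≤ e₀4^{-n}`, `k⃗ ∈ sectorBox θ_{m,ω} (B₁(n,m)) (B₂(n,m))`;
* `norm_genPropagator_le` — `‖g‖ ≤ 128 B₁(n,m) B₂(n,m)` (sup × volume);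
* the isotropic case (`isoPropagator = genPropagator n (2n)`): `norm_isoPropagator_le` and
  **`exists_norm_isoPropagator_le`: `‖ḡ^{(-n)}_ω̄(x₀, x⃗)‖ ≤ C · 4^{-n} 4^{-n}`** (`= Cγ^{2h}`, BGM
  (2.60) at `N = 0`): both isotropic extents are `O(4^{-n})`.

Everything is PROVED; the definitions are `genSymbol`, `genPropagator`, `genNormalExtent`,
`genTangentExtent`, `isoSymbol`, `isoPropagator`.

## Sources

* G. Benfatto, A. Giuliani, V. Mastropietro, Ann. Henri Poincaré 7 (2006) 809–898, §2.5
  (2.57)–(2.60) (arXiv:cond-mat/0507686 pp. 11–12). [BenfattoGiulianiMastropietro2006]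
* G. Benfatto, A. Giuliani, V. Mastropietro, Ann. Henri Poincaré 4 (2003) 137–193, §7.2.
  [BenfattoGiulianiMastropietro2003]
-/

noncomputable section

open Real Set MeasureTheory Complex
open scoped Topology

namespace Literature.MathematicalPhysics.QuantumLattice

/-! ### The two-index symbol -/

/-- **The two-index sector symbol** `f_{-n} ζ_{m,ω} χ / (-ik₀ + ε - μ)`. [cite: BenfattoGiulianiMastropietro2006, §2.5 (2.49), (2.59)] -/
def genSymbol (e₀ μ : ℝ) (n m : ℕ) (ω : ℤ) (p : ℝ × (Fin 2 → ℝ)) : ℂ :=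
  ((sectorCutoffGen e₀ μ n m ω p * zoneBump p.2 : ℝ) : ℂ) / sectorDenom μ p

/-- **The two-index sector propagator** `∫ e^{i(k⃗·x⃗ - k₀x₀)} f_{-n} ζ_{m,ω} χ / D`. [cite: BenfattoGiulianiMastropietro2006, §2.5 (2.49), (2.59)] -/
def genPropagator (e₀ μ : ℝ) (n m : ℕ) (ω : ℤ) (x₀ : ℝ) (x : Fin 2 → ℝ) : ℂ :=
  ∫ p : ℝ × (Fin 2 → ℝ), Complex.exp (((p.2 0 * x 0 + p.2 1 * x 1 - p.1 * x₀ : ℝ) : ℂ) * Complex.I) *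
    genSymbol e₀ μ n m ω p

/-- **The isotropic symbol** (`m = 2n`). [cite: BenfattoGiulianiMastropietro2006, §2.5 (2.59)] -/
def isoSymbol (e₀ μ : ℝ) (n : ℕ) (ω : ℤ) (p : ℝ × (Fin 2 → ℝ)) : ℂ := genSymbol e₀ μ n (2 * n) ω p

/-- **The isotropic single-scale propagator `ḡ^{(h)}_ω̄`** (`m = 2n`). [cite: BenfattoGiulianiMastropietro2006, §2.5 (2.59)] -/
def isoPropagator (e₀ μ : ℝ) (n : ℕ) (ω : ℤ) (x₀ : ℝ) (x : Fin 2 → ℝ) : ℂ := genPropagator e₀ μ n (2 * n) ω x₀ x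

/-- The anisotropic symbol is the case `m = n`. [folklore] -/
theorem sectorSymbol_eq_gen (e₀ μ : ℝ) (n : ℕ) (ω : ℤ) : sectorSymbol e₀ μ n ω = genSymbol e₀ μ n n ω := rfl

/-- The anisotropic propagator is the case `m = n`. [folklore] -/
theorem sectorPropagator_eq_gen (e₀ μ : ℝ) (n : ℕ) (ω : ℤ) : sectorPropagator e₀ μ n ω = genPropagator e₀ μ n n ω := rfl

/-- **`‖symbol‖ ≤ (e₀ 4^{-n-2})⁻¹`** (the denominator is `≥ e₀γ^{h-2}` on the shell). [cite: BenfattoGiulianiMastropietro2006, §2.5 (2.49)–(2.50)] -/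
theorem norm_genSymbol_le {e₀ μ : ℝ} (he : 0 < e₀) (n m : ℕ) (ω : ℤ) (p : ℝ × (Fin 2 → ℝ)) :
    ‖genSymbol e₀ μ n m ω p‖ ≤ (e₀ * (4 : ℝ) ^ (-(n : ℤ) - 2))⁻¹ := by
  have hlow : 0 < e₀ * (4 : ℝ) ^ (-(n : ℤ) - 2) := mul_pos he (zpow_pos (by norm_num) _)
  by_cases hF : sectorCutoffGen e₀ μ n m ω p = 0
  · simp only [genSymbol, hF, zero_mul, Complex.ofReal_zero, zero_div, norm_zero]
    exact inv_nonneg.2 hlow.le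
  · have hD := (sectorCutoffGen_ne_zero_scale he hF).1
    rw [← norm_sectorDenom] at hD
    have hI := sectorCutoffGen_mem_Icc he n m ω p (μ := μ)
    have hnum : ‖((sectorCutoffGen e₀ μ n m ω p * zoneBump p.2 : ℝ) : ℂ)‖ ≤ 1 := by
      rw [Complex.norm_real, Real.norm_eq_abs, abs_of_nonneg (mul_nonneg hI.1 (zoneBump_mem_Icc p.2).1)]
      exact mul_le_one₀ hI.2 (zoneBump_mem_Icc p.2).1 (zoneBump_mem_Icc p.2).2
    rw [genSymbol, norm_div]
    calc _ ≤ 1 / ‖sectorDenom μ p‖ := div_le_div_of_nonneg_right hnum (norm_nonneg _)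
      _ ≤ 1 / (e₀ * (4 : ℝ) ^ (-(n : ℤ) - 2)) := one_div_le_one_div_of_le hlow hD.le
      _ = _ := one_div _

/-- The two-index normal extent `B₁(n,m) = C_r e₀ 4^{-n} + C_n (¾ w_m)²`. [cite: BenfattoGiulianiMastropietro2006, §2.5 (2.47), (2.58)] -/
def genNormalExtent (μ e₀ : ℝ) (n m : ℕ) : ℝ :=
  π / (4 * Real.sqrt ((4 + μ) / 2)) * (e₀ * (4 : ℝ) ^ (-(n : ℤ))) +
    2 * accelBound μ * Real.sqrt (π ^ 2 / 8 + (4 * π ^ 3 / (μ + 4)) ^ 2) / Real.sqrt (μ + 4) *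
      (3 * sectorWidth m / 4) ^ 2

/-- The two-index tangential extent `B₂(n,m) = C_r e₀ 4^{-n} + 2√K (¾ w_m)`. [cite: BenfattoGiulianiMastropietro2006, §2.5 (2.47), (2.58)] -/
def genTangentExtent (μ e₀ : ℝ) (n m : ℕ) : ℝ :=
  π / (4 * Real.sqrt ((4 + μ) / 2)) * (e₀ * (4 : ℝ) ^ (-(n : ℤ))) +
    2 * Real.sqrt (π ^ 2 / 8 + (4 * π ^ 3 / (μ + 4)) ^ 2) * (3 * sectorWidth m / 4)

/-- `B₁(n,n)`, `B₂(n,n)` are the anisotropic extents; `B₁(n,2n)`, `B₂(n,2n)` the isotropic ones. [folklore] -/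
theorem genExtent_eq (μ e₀ : ℝ) (n : ℕ) :
    genNormalExtent μ e₀ n n = normalExtent μ e₀ n ∧ genTangentExtent μ e₀ n n = tangentExtent μ e₀ n ∧
      genNormalExtent μ e₀ n (2 * n) = isoNormalExtent μ e₀ n ∧ genTangentExtent μ e₀ n (2 * n) = isoTangentExtent μ e₀ n :=
  ⟨rfl, rfl, rfl, rfl⟩

section Bound

variable {μ : ℝ} (hμ₁ : -4 < μ) (hμ₂ : μ < -2 - Real.sqrt 2)
include hμ₁ hμ₂

/-- `0 ≤ B₁(n,m)`. [folklore] -/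
theorem genNormalExtent_nonneg {e₀ : ℝ} (he : 0 < e₀) (n m : ℕ) : 0 ≤ genNormalExtent μ e₀ n m := by
  have hA : 0 ≤ accelBound μ := (abs_nonneg _).trans (abs_fermiAX_le hμ₁ hμ₂ 0)
  have h4 : 0 < 4 + μ := by linarith
  have h4' : 0 < μ + 4 := by linarith
  unfold genNormalExtent
  positivity

omit hμ₂ in
/-- `0 ≤ B₂(n,m)`. [folklore] -/
theorem genTangentExtent_nonneg {e₀ : ℝ} (he : 0 < e₀) (n m : ℕ) : 0 ≤ genTangentExtent μ e₀ n m := by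
  have h4 : 0 < 4 + μ := by linarith
  have hw := (sectorWidth_pos m).le
  unfold genTangentExtent
  positivity

/-- **The support of the two-index symbol**: `|k₀| ≤ e₀4^{-n}` and `k⃗` in the sector box at
`θ_{m,ω}` with sides `B₁(n,m)`, `B₂(n,m)`. [cite: BenfattoGiulianiMastropietro2006, §2.5 (2.46)–(2.47), (2.58)] -/
theorem genSymbol_ne_zero {e₀ : ℝ} (he : 0 < e₀) (he' : e₀ ≤ (4 + μ) / 2) {n m : ℕ} {ω : ℤ}
    {p : ℝ × (Fin 2 → ℝ)} (h : genSymbol e₀ μ n m ω p ≠ 0) :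
    p.1 ∈ Icc (-(e₀ * (4 : ℝ) ^ (-(n : ℤ)))) (e₀ * (4 : ℝ) ^ (-(n : ℤ))) ∧
      p.2 ∈ sectorBox μ (((ω : ℝ) + 1 / 2) * sectorWidth m) (genNormalExtent μ e₀ n m) (genTangentExtent μ e₀ n m) := by
  have hnum : sectorCutoffGen e₀ μ n m ω p * zoneBump p.2 ≠ 0 := by
    intro h0
    apply h
    rw [genSymbol, h0, Complex.ofReal_zero, zero_div]
  have hF : sectorCutoffGen e₀ μ n m ω (p.1, p.2) ≠ 0 := left_ne_zero_of_mul hnum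
  have hχ : zoneBump p.2 ≠ 0 := right_ne_zero_of_mul hnum
  have hk := norm_le_of_zoneBump_ne_zero hχ
  refine ⟨?_, abs_normalCoord_le_of_gen_ne_zero hμ₁ hμ₂ he he' hk hF,
    abs_tangentCoord_le_of_gen_ne_zero hμ₁ hμ₂ he he' hk hF⟩
  have hsc := (sectorCutoffGen_ne_zero_scale he hF).2
  have hk0 : |p.1| ≤ Real.sqrt (p.1 ^ 2 + (sqDispersion p.2 - μ) ^ 2) := by
    rw [← Real.sqrt_sq_eq_abs]
    exact Real.sqrt_le_sqrt (by nlinarith)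
  exact abs_le.1 (hk0.trans hsc.le)

/-- **The dimensional bound for the two-index propagator**: `‖g‖ ≤ 128 B₁(n,m) B₂(n,m)` (sup of the
symbol times the volume of its support). [cite: BenfattoGiulianiMastropietro2006, §2.5 Lemma 2.2 / Lemma 2.3] -/
theorem norm_genPropagator_le {e₀ : ℝ} (he : 0 < e₀) (he' : e₀ ≤ (4 + μ) / 2) (n m : ℕ) (ω : ℤ)
    (x₀ : ℝ) (x : Fin 2 → ℝ) :
    ‖genPropagator e₀ μ n m ω x₀ x‖ ≤ 128 * (genNormalExtent μ e₀ n m * genTangentExtent μ e₀ n m) := by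
  set θ₀ : ℝ := ((ω : ℝ) + 1 / 2) * sectorWidth m with hθ₀
  set a : ℝ := e₀ * (4 : ℝ) ^ (-(n : ℤ)) with ha
  set B₁ := genNormalExtent μ e₀ n m with hB₁
  set B₂ := genTangentExtent μ e₀ n m with hB₂
  have ha0 : 0 < a := mul_pos he (zpow_pos (by norm_num) _)
  have hB₁0 : 0 ≤ B₁ := genNormalExtent_nonneg hμ₁ hμ₂ he n m
  have hB₂0 : 0 ≤ B₂ := genTangentExtent_nonneg hμ₁ he n m
  set M : ℝ := (e₀ * (4 : ℝ) ^ (-(n : ℤ) - 2))⁻¹ with hM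
  have hM0 : 0 ≤ M := by rw [hM]; exact inv_nonneg.2 (mul_pos he (zpow_pos (by norm_num) _)).le
  set T : Set (ℝ × (Fin 2 → ℝ)) := Icc (-a) a ×ˢ sectorBox μ θ₀ B₁ B₂ with hT
  set f : ℝ × (Fin 2 → ℝ) → ℂ := fun p =>
    Complex.exp (((p.2 0 * x 0 + p.2 1 * x 1 - p.1 * x₀ : ℝ) : ℂ) * Complex.I) * genSymbol e₀ μ n m ω p with hf
  have hfM : ∀ p, ‖f p‖ ≤ M := fun p => by
    rw [hf]
    simp only [norm_mul, Complex.norm_exp_ofReal_mul_I, one_mul]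
    exact norm_genSymbol_le he n m ω p
  have hfT : ∀ p, p ∉ T → f p = 0 := by
    intro p hp
    by_contra hne
    have hS : genSymbol e₀ μ n m ω p ≠ 0 := right_ne_zero_of_mul hne
    obtain ⟨h1, h2⟩ := genSymbol_ne_zero hμ₁ hμ₂ he he' hS
    exact hp (mk_mem_prod h1 h2)
  have hvol : volume T ≤ ENNReal.ofReal (2 * a) * (ENNReal.ofReal (2 * B₁) * ENNReal.ofReal (2 * B₂)) := by
    rw [hT, MeasureTheory.Measure.volume_eq_prod, Measure.prod_prod, Real.volume_Icc, show a - -a = 2 * a by ring]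
    gcongr
    exact volume_sectorBox_le hμ₁ hμ₂ θ₀ B₁ B₂
  have hvolT : volume T < ⊤ := lt_of_le_of_lt hvol (by
    refine ENNReal.mul_lt_top ENNReal.ofReal_lt_top (ENNReal.mul_lt_top ENNReal.ofReal_lt_top ENNReal.ofReal_lt_top))
  have hvolR : (volume T).toReal ≤ 2 * a * (2 * B₁ * (2 * B₂)) := by
    have := ENNReal.toReal_mono (by
      refine ENNReal.mul_ne_top ENNReal.ofReal_ne_top (ENNReal.mul_ne_top ENNReal.ofReal_ne_top ENNReal.ofReal_ne_top)) hvol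
    rwa [ENNReal.toReal_mul, ENNReal.toReal_mul, ENNReal.toReal_ofReal (by positivity),
      ENNReal.toReal_ofReal (by positivity), ENNReal.toReal_ofReal (by positivity)] at this
  calc ‖genPropagator e₀ μ n m ω x₀ x‖ = ‖∫ p, f p‖ := rfl
    _ = ‖∫ p in T, f p‖ := by rw [setIntegral_eq_integral_of_forall_compl_eq_zero hfT]
    _ ≤ M * (volume T).toReal := norm_setIntegral_le_of_norm_le_const hvolT fun p _ => hfM p
    _ ≤ M * (2 * a * (2 * B₁ * (2 * B₂))) := mul_le_mul_of_nonneg_left hvolR hM0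
    _ = 128 * (B₁ * B₂) := by
        rw [hM, ha, zpow_sub₀ (by norm_num : (4 : ℝ) ≠ 0)]
        field_simp
        ring

/-- The isotropic case: `‖ḡ‖ ≤ 128 B̄₁(n) B̄₂(n)`. [cite: BenfattoGiulianiMastropietro2006, §2.5 (2.60)] -/
theorem norm_isoPropagator_le {e₀ : ℝ} (he : 0 < e₀) (he' : e₀ ≤ (4 + μ) / 2) (n : ℕ) (ω : ℤ) (x₀ : ℝ) (x : Fin 2 → ℝ) :
    ‖isoPropagator e₀ μ n ω x₀ x‖ ≤ 128 * (isoNormalExtent μ e₀ n * isoTangentExtent μ e₀ n) :=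
  norm_genPropagator_le hμ₁ hμ₂ he he' n (2 * n) ω x₀ x

/-- **`|ḡ^{(h)}_ω̄(x)| ≤ C γ^{2h}`** (BGM 2006 (2.60) at order zero): `‖isoPropagator‖ ≤ C·4^{-n}4^{-n}`
for all `n, ω̄, x`, both isotropic extents being `O(4^{-n})`. [cite: BenfattoGiulianiMastropietro2006, §2.5 Lemma 2.3 (2.60)] -/
theorem exists_norm_isoPropagator_le {e₀ : ℝ} (he : 0 < e₀) (he' : e₀ ≤ (4 + μ) / 2) :
    ∃ C : ℝ, 0 ≤ C ∧ ∀ (n : ℕ) (ω : ℤ) (x₀ : ℝ) (x : Fin 2 → ℝ),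
      ‖isoPropagator e₀ μ n ω x₀ x‖ ≤ C * ((4 : ℝ) ^ (-(n : ℤ)) * (4 : ℝ) ^ (-(n : ℤ))) := by
  have h4 : 0 < 4 + μ := by linarith
  have h4' : 0 < μ + 4 := by linarith
  have hA : 0 ≤ accelBound μ := (abs_nonneg _).trans (abs_fermiAX_le hμ₁ hμ₂ 0)
  set c₁ : ℝ := π / (4 * Real.sqrt ((4 + μ) / 2)) * e₀ +
    2 * accelBound μ * Real.sqrt (π ^ 2 / 8 + (4 * π ^ 3 / (μ + 4)) ^ 2) / Real.sqrt (μ + 4) * (9 / 16 * π ^ 2) with hc₁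
  set c₂ : ℝ := π / (4 * Real.sqrt ((4 + μ) / 2)) * e₀ + 2 * Real.sqrt (π ^ 2 / 8 + (4 * π ^ 3 / (μ + 4)) ^ 2) * (3 / 4 * π)
    with hc₂
  have hc₁0 : 0 ≤ c₁ := by positivity
  refine ⟨128 * (c₁ * c₂), by positivity, fun n ω x₀ x => ?_⟩
  obtain ⟨hB₁, hB₂⟩ := isoExtent_le hμ₁ n (μ := μ) (e₀ := e₀)
  have hB₁0 : 0 ≤ isoNormalExtent μ e₀ n := isoNormalExtent_nonneg hμ₁ hμ₂ he n
  have hB₂0 : 0 ≤ isoTangentExtent μ e₀ n := isoTangentExtent_nonneg hμ₁ he n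
  have h4pos : 0 < (4 : ℝ) ^ (-(n : ℤ)) := zpow_pos (by norm_num) _
  calc ‖isoPropagator e₀ μ n ω x₀ x‖ ≤ 128 * (isoNormalExtent μ e₀ n * isoTangentExtent μ e₀ n) :=
        norm_isoPropagator_le hμ₁ hμ₂ he he' n ω x₀ x
    _ ≤ 128 * ((c₁ * (4 : ℝ) ^ (-(n : ℤ))) * (c₂ * (4 : ℝ) ^ (-(n : ℤ)))) := by
        refine mul_le_mul_of_nonneg_left (mul_le_mul hB₁ (le_of_eq hB₂) hB₂0 (by positivity)) (by norm_num)
    _ = 128 * (c₁ * c₂) * ((4 : ℝ) ^ (-(n : ℤ)) * (4 : ℝ) ^ (-(n : ℤ))) := by ring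

end Bound

end Literature.MathematicalPhysics.QuantumLattice

end
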